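/-
Copyright (c) 2026 the pub-hodgecm-mathlib formalisation cell (harness21).  Prover seat hodgecm-mathlib-LH4-p12 (g9), req620 Track A «(D-RAM) FOUR-FRAME» squad
(STAGE-1b, row (2) of the piece `f_{T₊}`, the (β₂) road (R-36) «PURE-CELL LEDGER»; K6 desk LH4-p16 (g3) WORD #10 ∕ #13 (a)(b) «the top cell, both parities, one mechanism»;
the parity-uniform, generator-transferable form of ★ p864658 `…RowTowerVertexLettersOddDTop`), 2026-09-05.
-/
import Summits.HodgeConjecture.HodgeConjecture.Theorems.F0P3cDyRamRowCleanCellBit            -- ★ (LH4-p06 (g9)): `line_entry_mul_map_eq_one`; brings ★ p863084 `…RowCellOnShell`, ★ p862869 `…ConeCellPresentation`, ★ `…ConeCellNormFibre`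
import Summits.HodgeConjecture.HodgeConjecture.Theorems.F0P3cDyRamRowVertexAffineSignLabelOnShell  -- ★ p864617 «M1-NX» (this seat), ED. 2 HEAD-W `valueSet_rowVertex_eq_xPlus_iff_affineSign_of_onShell_of_near`; brings ★ M1 p863628, ★ p863048, ★ p862871
import Summits.HodgeConjecture.HodgeConjecture.Theorems.F0P3cDyRamRowCellSocketReads           -- ★ p863914 (LH4-p16 (g2)): frame conventions; brings ★ p863859 `glue_fixed_unit`, `pairing_mul_normPow_eq`, ★ p863477 `trace_letters`
import Summits.HodgeConjecture.HodgeConjecture.Theorems.F0P3cDyRamShellOfExactLevel           -- ★ p863487 (LH7-p09 (g2)) FILE 10: `latticeNearTransvShell_iff_exactLevel_of_prod`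
import Summits.HodgeConjecture.HodgeConjecture.Theorems.F0P3cDyRamUpperLineRayLetters          -- ★ p864080 (this seat): `exactLevel_iff_v_rayScalar_eq` (exact level `ℓ₀` ↔ `|e₀| = |ϖ|^{ℓ₀}`)
import HarnessLib

/-!
# Crux `H413`, line LH4 «(D-RAM) FOUR-FRAME» — STAGE-1b, row (2), the (β₂) road (R-36), K6 road F1-top: «THE LETTERS OF A TOP-CELL VERTEX — BOTH PARITIES, AT ANY NEAR COORDINATE» — for a
# glued vertex `L₃` over a member `Λ` of the TOP window cell `(j, b)` (`b < j`, `j + b + d%2 ≤ jl`) of the live row `2b + d%2 = m`, read in the TOP chart (`|ξ₀| = exp(jl − m)`, `g = 0`):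
# the vertex is on the `(d%2, M)`-shell IFF its presentation coordinate `V₁` is ON THE SHELL `NX(V) :⟺ |μ_a + μ_b(R₀ + Vγ₀)| = |ϖ|^{2b+d%2}`, and THEN, at EVERY on-shell `σ`-fixed
# integral `W` with `|μ_bγ₀|·|W − V₁| ≤ |ϖ|^{2b+m⋆}` (the coordinate of ANY generator of `Λ`), `VS_{m⋆}(Γ − 1 ∣ L₃) = VS_{m⋆}(X₊) ↔ ω(pw·(ϖσϖ)^b)·ω(α₁ + γ₁·W) = 1`

Cell `hodgecm-mathlib` (D-0151), FLOOR 0, crux item H413 = `stmt-HodgeConjecture-24833`, route of record `HCCMUnconditional`; squad F0∕P3c∕LH4; lane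
`--supports stmt-HodgeConjecture-24833 --as helper` (count-neutral; pays NO tier-0 row).  THEOREMS ONLY (no `def`, no instance, no notation, no `sorry`, default heartbeats);
★-only imports; states NO law; (β₂) stays a HYPOTHESIS.  Binders of the HEAD = ★ p864658 `…RowTowerVertexLettersOddDTop.rowTower_topVertex_letters_odd`'s (★ F1a p864529's
‹OFF.letter.v1› subset by name and byte, fence `mcOfRecord d ≤ m`, deep tokens, `hFgap`, `hbj : b < j` STRICT, `hjm : j + m⋆ ≤ jl`, the TOP chart, the ON-SHELL dictionary `haff`)
made PARITY-UNIFORM: the row letter is `hbm : 2 * b + d % 2 = m` (K6 desk's spelling, ★ `…RowInsideChartLetters`) and there is NO parity letter; `hcell : j + b + d % 2 ≤ jl`,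
`hξv : |ξ₀|·|jEϖ|^{jl} = |jEϖ|^{2b+d%2}` (`|b̂| = |μ_bγ₀| = |â| = |ϖ|^{2b+d%2}`).  (The lone cell of an `N = 0` window, `j = b`, `jl = m`, is NOT read: `hâ`'s domination needs `jl > m`.)
WHY A SECOND FILE AFTER ★ p864658 (K6 desk WORD #13 (a)(b); this seat 02:5xZ).  ★ K6-0's socket (★ p864195 reads₃) reads the label at the coordinate `Vf x₀` of an ARBITRARY generator
`x₀` of `Λ`, which differs from the presentation's `V₁` by `≤ r` (★ F1b §1); on inside cells ★ F1b §2 transfers the label by unit-coset constancy (`|γ₁| < 1`), but in the TOP chart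
`|γ₁| = 1` and `α₁ + γ₁W` has a zero in the digit disc — the label is constant only ON the shell, and the transfer must go through the dictionary itself (★ p864617 ED. 2 HEAD-W:
`pw·P·(â′ + b̂′W) = e₀ + pw·μ_bγ₀·(W − V₁)`).  So this file states the top-cell letters ONCE for both parities with the label clause quantified over near on-shell `W`; ★ p864658 (odd,
`W := V₁`) is its corollary and stays as landed.
THIS FILE, TWO theorems:
* §1 `latticeNearTransvShell_iff_v_rayScalar_eq_pow` — ★ FILE 10 `latticeNearTransvShell_iff_exactLevel_of_prod` ∘ ★ p864080 `exactLevel_iff_v_rayScalar_eq` at a GENERAL `ℓ₀`: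
  for a glued `L` over `Λ = x₀·𝒪_cc` with Gram-level `|Y| = |ϖE|^b`, FILE 10's letters at `(ℓ₀, k, M)`, the four level-`(ℓ₀+1)` letters and `jE e₀ = Tr_ρ(μ ∕ (cc(α − ρα)ΘY))`:
  **`LatticeNearTransvShell ϖ ℓ₀ M (Γ − 1) L ↔ |e₀| = |ϖ|^{ℓ₀}`** (★ p864193 HEAD-bd is `ℓ₀ = 1`).
* HEAD `rowTower_topVertex_letters` — ∃ presentation `(x₁, w₀, V₁)` with ★ F1a's 13 (L) letters VERBATIM and: (S′) for every square level `d % 2 ≤ M ≤ mcOfRecord d`,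
  **`LatticeNearTransvShell ϖ (d % 2) M (Γ − 1) L₃ ↔ NX V₁`**; (L′-W) **`NX V₁ → ∀ W, σ W = W → |W| ≤ 1 → NX W → |μ_bγ₀|·|W − V₁| ≤ |ϖ|^{2b+m⋆} →
  (VS_{m⋆}(Γ − 1 ∣ L₃) = VS_{m⋆}(X₊) ↔ normSign σ (pw·(ϖσϖ)^b)·normSign σ (α₁ + γ₁W) = 1)`**, `NX V :⟺ Valued.v (μa + μb * (R₀ + V * γ₀)) = Valued.v ϖ ^ (2 * b + d % 2)`.
So ONE F1b-top serves ‹CORE-ODD›'s boundary cell (`d` odd, `j + b + 1 = jl`) AND ‹CORE-3›'s terminal cell (`d` even, `j + b = jl`) in ★ K6-0's socket with that `NX` (locally constant on digit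
balls of radius `< 1`) and the transfer radius `r ≤ |ϖ|^{2d−1}` (`|μ_bγ₀| = |ϖ|^{2b+d%2}`, `m⋆ = d%2 + 2d − 1`).
WHAT IS NOT CLAIMED: any count, the population constant, which digits are on the shell, the NX-sphere character sum ((g-top), LH4-p11), the `N = 0` window, ‹TERM›.
HONEST LABEL.  Count-neutral lattice ∕ valuation bookkeeping; nothing printed is asserted; no census law is stated; ‹CORE-3›∕‹CORE-ODD›∕‹FLIPVAL›∕β₂ `stub_law_cleanSgn₂` UNPROVED; `HC_CM` is
proved only modulo the 7 printed citations (2 remaining named inputs: hLiu418 = `stmt-HodgeConjecture-24832`, h413 = `stmt-HodgeConjecture-24833`) until rung 0 closes.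
## References
* [Jacobowitz1962] R. Jacobowitz, *Hermitian forms over local fields*, Amer. J. Math. 84 (1962): §4 (dual lattices, gluing).
* [Kottwitz1986BaseChangeUnits] R. E. Kottwitz, *Base change for unit elements of Hecke algebras*, Compositio Math. 60 (1986): §1 pp. 240–241 (signed lattice counts cell by cell).
* [Rogawski1990] J. D. Rogawski, *Automorphic Representations of Unitary Groups in Three Variables*, Ann. of Math. Stud. 123 (1990): §4.9 Prop. 4.9.1 (b) p. 55.
* [Serre1979] J.-P. Serre, *Local Fields*, GTM 67 (1979): Ch. III §6 Prop. 12; Ch. V §3 Cor. 3; Ch. XV §2.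
-/

set_option autoImplicit false

noncomputable section

namespace Summit.HodgeConjecture.HodgeConjecture.Cruxes.H413.F0P3cDyRamRowTowerTopVertexLetters

open scoped Valued WithZero Matrix MatrixGroups Classical
open WithZero
open Literature.NumberTheory.Automorphic Literature.NumberTheory.Automorphic.HermitianLattice Literature.NumberTheory.Automorphic.UnitaryLatticeTree
open Literature.NumberTheory.Automorphic.UnitaryThreeFourFrame (IsRamifiedQuadraticDatum normSign)
open Literature.NumberTheory.Rogawski1990
open Summit.HodgeConjecture.HodgeConjecture.Cruxes.H413.F0P3cDyRamFourFramePieces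
open Summit.HodgeConjecture.HodgeConjecture.Cruxes.H413.F0P3cDyRamFourFrameCensusDefs (LatticeInLevel LatticeNearTransvShell)
open Summit.HodgeConjecture.HodgeConjecture.Cruxes.H413.F0P3cDyRamStageOneBDefs (mcOfRecord)
open Summit.HodgeConjecture.HodgeConjecture.Cruxes.H413.F0P3cDyRamToricCensusDefs
open Summit.HodgeConjecture.HodgeConjecture.Cruxes.H413.F0P3cDyRamRowCellOnShell (uniformizer_letters)
open Summit.HodgeConjecture.HodgeConjecture.Cruxes.H413.F0P3cDyRamShellOfExactLevel (latticeNearTransvShell_iff_exactLevel_of_prod)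
open Summit.HodgeConjecture.HodgeConjecture.Cruxes.H413.F0P3cDyRamUpperLineRayLetters (exactLevel_iff_v_rayScalar_eq)
open Summit.HodgeConjecture.HodgeConjecture.Cruxes.H413.F0P3cDyRamConeCellPresentation (exists_presentation_of_mem_levelSetDep)
open Summit.HodgeConjecture.HodgeConjecture.Cruxes.H413.F0P3cDyRamConeLevelTransport (exists_map_eq_glueUnit)
open Summit.HodgeConjecture.HodgeConjecture.Cruxes.H413.F0P3cDyRamRowCleanCellBit (line_entry_mul_map_eq_one)
open Summit.HodgeConjecture.HodgeConjecture.Cruxes.H413.F0P3cDyRamTerminalCellOffShellCardTwo (map_sub_div_eq map_sub_mul_eq)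
open Summit.HodgeConjecture.HodgeConjecture.Cruxes.H413.F0P3cDyRamDiagonalCellLetter (inv_add_map_inv_eq_map_pairing)
open Summit.HodgeConjecture.HodgeConjecture.Cruxes.H413.F0P3cDyRamRowVertexAffineCoordinate (map_cellScalar_theta exists_coord_of_vertex)
open Summit.HodgeConjecture.HodgeConjecture.Cruxes.H413.F0P3cDyRamRowVertexPopulationRead (glue_fixed_unit pairing_mul_normPow_eq)
open Summit.HodgeConjecture.HodgeConjecture.Cruxes.H413.F0P3cDyRamRowVertexAffineCoordinate (rayScalar_eq_affine)
open Summit.HodgeConjecture.HodgeConjecture.Cruxes.H413.F0P3cDyRamRowVertexAffineSignLabelOnShell (valueSet_rowVertex_eq_xPlus_iff_affineSign_of_onShell_of_near)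

variable {E M : Type} [Field E] [Valued E ℤᵐ⁰] [Field M] [Valued M ℤᵐ⁰]

/-! ## §1 The `(ℓ₀, M)`-shell ↔ `|e₀| = |ϖ|^{ℓ₀}` (★ FILE 10 ∘ ★ p864080, general `ℓ₀`) -/

/-- **§1 — «THE `(ℓ₀, M)`-SHELL IS THE EXACT LEVEL OF THE RAY SCALAR».**  Frame of ★ FILE 10 (glued `L ⊃ B ↦ Λ = x₀·𝒪_cc`, tube `b`, Gram-level `|Y| = |ϖE|^b`), ★ FILE 10's letters at
`(ℓ₀, k, M)` (`ℓ₀ + k = M`, `|u₀₀ − 1| ≤ |ϖ^k|`, `|μ| ≤ |ϖE|^k`, `|μ|·|μ − ρμ| ≤ |cc(α − ρα)|·|Y|·|ϖE|^M`), ★ p864080's four level-`(ℓ₀+1)` letters, and `jE e₀ = μ∕D₀ + ρ(μ∕D₀)`,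
`D₀ = cc(α − ρα)ΘY`.  THEN `LatticeNearTransvShell ϖ ℓ₀ M (Γ − 1) L ↔ |e₀| = |ϖ|^{ℓ₀}` (★ p864193 HEAD-bd `…_one_iff_…` is the case `ℓ₀ = 1`).
[cite: Rogawski1990, §4.9 Prop. 4.9.1 (b) p. 55] [cite: Jacobowitz1962, §4] [cite: Serre1979, Ch. V §3 Cor. 3] -/
theorem latticeNearTransvShell_iff_v_rayScalar_eq_pow {ρ Θ : M →+* M} {α : M}
    (hρρ : ∀ x, ρ (ρ x) = x) (hvρ : ∀ x, Valued.v (ρ x) = Valued.v x) (hΘΘ : ∀ x, Θ (Θ x) = x) (hΘρ : ∀ x, Θ (ρ x) = ρ (Θ x))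
    (hvΘ : ∀ x, Valued.v (Θ x) = Valued.v x) {ϖ : E} (hϖ : Valued.v ϖ = exp (-1 : ℤ))
    (jE : E →+* M) (hjv : ∀ c, Valued.v (jE c) ≤ 1 ↔ Valued.v c ≤ 1) (hjfix : ∀ z, ρ z = z ↔ ∃ c, jE c = z)
    (φ : (Fin 2 → E) →+ M) (hφs : ∀ (c : E) (x : Fin 2 → E), φ (c • x) = jE c * φ x) (hφi : Function.Injective φ)
    {γ₂ : GL (Fin 2) E} {lam h : M} (hφγ : ∀ x, φ ((γ₂ : Matrix (Fin 2) (Fin 2) E) *ᵥ x) = lam * φ x) (hΘh : Θ h = h)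
    {L : Submodule 𝒪[E] (Fin 3 → E)} {b : ℕ} (hb : ∀ a : E, (Pi.single 1 a : Fin 3 → E) ∈ L ↔ Valued.v a ≤ Valued.v ϖ ^ b)
    (hpr : ∀ x ∈ L, Valued.v (x 1) * Valued.v ϖ ^ b ≤ 1)
    {B₂ : Submodule 𝒪[E] (Fin 2 → E)} {w₀ : Fin 2 → E} {g₀ : Fin 3 → E}
    (hB : B₂.map ((Matrix.toLin' (!![1, 0; 0, 0; 0, 1] : Matrix (Fin 3) (Fin 2) E)).restrictScalars 𝒪[E]) =
      L ⊓ LinearMap.ker ((LinearMap.proj (1 : Fin 3) : (Fin 3 → E) →ₗ[E] E).restrictScalars 𝒪[E]))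
    (hg₀ : g₀ ∈ L) (hg₀1 : Valued.v (g₀ 1) * Valued.v ϖ ^ b = 1) (hprg : g₀ - Pi.single 1 (g₀ 1) = ![w₀ 0, 0, w₀ 1])
    {Λ : AddSubgroup M} (hBΛ : B₂.toAddSubgroup.map φ = Λ) {cc x₀ : M} (hc : ρ cc = cc) (hcc : cc * (α - ρ α) ≠ 0) (hx₀ : x₀ ≠ 0)
    (hΛx : ∀ x, x ∈ Λ ↔ ∃ z, IsOrd ρ α cc z ∧ x = x₀ * z) (hw₀Y : φ w₀ = (dualGen ρ Θ α cc h x₀)⁻¹ * x₀)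
    (hYb : Valued.v (dualGen ρ Θ α cc h x₀) = Valued.v (jE ϖ) ^ b)
    (u : GL (Fin 1) E) (ℓ₀ k Ms : ℕ) (hmk : ℓ₀ + k = Ms)
    (huk : Valued.v ((u : Matrix (Fin 1) (Fin 1) E) 0 0 - 1) ≤ Valued.v (ϖ ^ k))
    (hμk : Valued.v (lam - jE ((u : Matrix (Fin 1) (Fin 1) E) 0 0)) ≤ Valued.v (jE ϖ) ^ k)
    (hprod : Valued.v (lam - jE ((u : Matrix (Fin 1) (Fin 1) E) 0 0)) * Valued.v ((lam - jE ((u : Matrix (Fin 1) (Fin 1) E) 0 0)) - ρ (lam - jE ((u : Matrix (Fin 1) (Fin 1) E) 0 0))) ≤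
      Valued.v (cc * (α - ρ α)) * Valued.v (dualGen ρ Θ α cc h x₀) * Valued.v (jE ϖ) ^ Ms)
    (hul : Valued.v ((u : Matrix (Fin 1) (Fin 1) E) 0 0 - 1) ≤ Valued.v (ϖ ^ (ℓ₀ + 1)))
    (hlam1 : Valued.v (lam - 1) ≤ Valued.v (jE ϖ) ^ (ℓ₀ + 1))
    (hlamρ : Valued.v (lam - ρ lam) ≤ Valued.v (cc * (α - ρ α)) * Valued.v (jE ϖ) ^ (ℓ₀ + 1))
    (hμl : Valued.v (lam - jE ((u : Matrix (Fin 1) (Fin 1) E) 0 0)) ≤ Valued.v (jE ϖ ^ (ℓ₀ + 1) * dualGen ρ Θ α cc h x₀))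
    {e₀ : E} (he₀ : jE e₀ = (lam - jE ((u : Matrix (Fin 1) (Fin 1) E) 0 0)) / (cc * (α - ρ α) * Θ (dualGen ρ Θ α cc h x₀)) +
      ρ ((lam - jE ((u : Matrix (Fin 1) (Fin 1) E) 0 0)) / (cc * (α - ρ α) * Θ (dualGen ρ Θ α cc h x₀)))) :
    LatticeNearTransvShell ϖ ℓ₀ Ms ((((endoGL (γ₂, u) : GL (Fin 3) E) : Matrix (Fin 3) (Fin 3) E) - 1)) L ↔ Valued.v e₀ = Valued.v ϖ ^ ℓ₀ := by
  obtain ⟨-, -, -, hvjϖ0, -, -, -⟩ := uniformizer_letters jE hjv hϖ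
  have hρϖ : ρ (jE ϖ) = jE ϖ := (hjfix _).2 ⟨ϖ, rfl⟩
  have hY0 : dualGen ρ Θ α cc h x₀ ≠ 0 := fun h0 => pow_ne_zero b hvjϖ0 (hYb.symm.trans (by rw [h0, Valuation.map_zero]))
  rw [latticeNearTransvShell_iff_exactLevel_of_prod hvρ hϖ jE hjv hjfix φ hφs hφi hφγ hb hpr hB hg₀ hg₀1 hprg hBΛ hx₀ hΛx hw₀Y hYb u ℓ₀ k Ms hmk huk hμk hprod,
    exactLevel_iff_v_rayScalar_eq hρρ hvρ hΘΘ hΘρ hvΘ hϖ jE hjv hρϖ φ hφs hφi hφγ hΘh hb hpr hB hg₀ hg₀1 hprg hBΛ hc hcc hx₀ hY0 hΛx hw₀Y u ℓ₀ hul hlam1 hlamρ hμl he₀]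

/-! ## §2 HEAD — the letters of a top-cell vertex, both parities, label at any near on-shell coordinate -/

/-- **HEAD — «THE LETTERS OF A TOP-CELL VERTEX» (F1-top, both parities).**  ★ p864658's block letters with the row `2b + d%2 = m` (no parity letter), fence and deep tokens, `hFgap`,
the cell `b < j`, `j + m⋆ ≤ jl`, the TOP chart `(κ₀, ξ₀; μ_a, μ_b, R₀, γ₀; α₁, γ₁, haff)` with `j + b + d%2 ≤ jl`, `|ξ₀|·|jEϖ|^{jl} = |jEϖ|^{2b+d%2}` and the ON-SHELL dictionary `haff`
(module docstring), and a glued vertex `(B, L₃)` over `Λ ∈ levelSetDep(j, b; lam − jE u₀₀)`.  THEN a presentation `(x₁, w₀, V₁)` with ★ F1a's (L) letters and: (S′) at every square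
level `d%2 ≤ M ≤ m_c`, `LatticeNearTransvShell ϖ (d%2) M (Γ − 1) L₃ ↔ |μ_a + μ_b(R₀ + V₁γ₀)| = |ϖ|^{2b+d%2}`; (L′-W) if `V₁` is on the shell then for EVERY `σ`-fixed integral on-shell
`W` with `|μ_bγ₀|·|W − V₁| ≤ |ϖ|^{2b+m⋆}`: `VS_{m⋆}(Γ − 1 ∣ L₃) = VS_{m⋆}(X₊) ↔ normSign σ (pw·(ϖσϖ)^b) · normSign σ (α₁ + γ₁W) = 1`.
[cite: Kottwitz1986BaseChangeUnits, §1 pp. 240–241] [cite: Rogawski1990, §4.9 Prop. 4.9.1 (b) p. 55] [cite: Jacobowitz1962, §4] [cite: Serre1979, Ch. V §3 Cor. 3; Ch. XV §2] -/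


theorem rowTower_topVertex_letters [CompleteSpace E] [IsDiscreteValuationRing 𝒪[E]] [Finite 𝓀[E]]
    (σ : E →+* E) (ϖ : E) (d tE : ℕ) (hD : IsRamifiedQuadraticDatum σ ϖ d tE)
    (jE : E →+* M) (ρ Θ : M →+* M) (α lam : M)
    (hρρ : ∀ z, ρ (ρ z) = z) (hvρ : ∀ z, Valued.v (ρ z) = Valued.v z)
    (hjv : ∀ a, Valued.v (jE a) ≤ 1 ↔ Valued.v a ≤ 1) (hjfix : ∀ z : M, ρ z = z ↔ ∃ a, jE a = z) (hΘj : ∀ a, Θ (jE a) = jE (σ a))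
    (hΘΘ : ∀ z, Θ (Θ z) = z) (hΘρ : ∀ z, Θ (ρ z) = ρ (Θ z)) (hvΘ : ∀ z, Valued.v (Θ z) = Valued.v z)
    (hα : ρ α ≠ α) (hα1 : Valued.v α ≤ 1) (hint : ∀ z : M, Valued.v z ≤ 1 → Valued.v ((z - ρ z) / (α - ρ α)) ≤ 1)
    (hvlam : Valued.v lam = 1) (hU : Valued.v (α - ρ α) = 1) (hjiso : ∀ a, Valued.v (jE a) = Valued.v a)
    (hjpow : ∀ (t : E) (n : ℤ), Valued.v (jE t) = Valued.v (jE ϖ) ^ n ↔ Valued.v t = Valued.v ϖ ^ n)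
    (hϖmax : ∀ t : M, ρ t = t → Valued.v t < 1 → Valued.v t ≤ Valued.v (jE ϖ))
    (γ₂ : GL (Fin 2) E) (u : GL (Fin 1) E) (m jl : ℕ) (hm : Valued.v (lam - jE ((u : Matrix (Fin 1) (Fin 1) E) 0 0)) = WithZero.exp (-(m : ℤ)))
    (hjl : Valued.v ((lam - jE ((u : Matrix (Fin 1) (Fin 1) E) 0 0)) - ρ (lam - jE ((u : Matrix (Fin 1) (Fin 1) E) 0 0))) = WithZero.exp (-(jl : ℤ)))
    (_hum : Valued.v (((u : Matrix (Fin 1) (Fin 1) E) 0 0) - 1) ≤ Valued.v (ϖ ^ mstarOfRecord d))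
    (H₂ : Matrix (Fin 2) (Fin 2) E) (hW : E) (hH₂ : IsUnit H₂.det) (hH₂σ : (H₂.map σ)ᵀ = H₂) (hhW : Valued.v hW = 1) (hhWσ : σ hW = hW)
    (φ : (Fin 2 → E) →+ M) (h : M) (hφs : ∀ (c : E) (x : Fin 2 → E), φ (c • x) = jE c * φ x) (hφi : Function.Injective φ) (hφo : Function.Surjective φ)
    (hφγ : ∀ x, φ ((γ₂ : Matrix (Fin 2) (Fin 2) E).mulVec x) = lam * φ x)
    (hform : ∀ x y, jE (pairing σ H₂ x y) = h * Θ (φ x) * φ y + ρ (h * Θ (φ x) * φ y)) (hΘh : Θ h = h) (hh : h ≠ 0)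
    (b : ℕ) (hbm : 2 * b + d % 2 = m)
    (hΘlam : Θ lam * lam = 1) (P₁ : GL (Fin 3) E)
    (hA : formCongr σ P₁ ((StdForm.antidiagonal 3).over E) = (!![H₂ 0 0, 0, H₂ 0 1; 0, hW, 0; H₂ 1 0, 0, H₂ 1 1] : Matrix (Fin 3) (Fin 3) E))
    (hΓ : P₁ * endoGL (γ₂, u) * P₁⁻¹ ∈ unitaryGroupOfForm σ ((StdForm.antidiagonal 3).over E))
    -- the fence and the deep tokens at `mcOfRecord d`, the class letter `hFgap`
    (hmcm : mcOfRecord d ≤ m) (hlamn : Valued.v (lam - 1) ≤ Valued.v (jE ϖ) ^ mcOfRecord d)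
    (hun : Valued.v ((u : Matrix (Fin 1) (Fin 1) E) 0 0 - 1) ≤ Valued.v ϖ ^ mcOfRecord d)
    (hFgap : ∀ z : M, ρ z = z → Θ z = z → Valued.v (jE ϖ) < Valued.v z → Valued.v z ≤ 1 → Valued.v z = 1)
    -- the cell
    {j : ℕ} (hbj : b < j) (hjm : j + mstarOfRecord d ≤ jl)
    -- the chart
    {κ₀ ξ₀ : M} (hκ₀ : κ₀ + ρ κ₀ = 1) (hΘκ₀ : Θ κ₀ = κ₀) (hκ₀1 : Valued.v κ₀ ≤ 1) (hξ : ρ ξ₀ = -ξ₀) (hΘξ : Θ ξ₀ = ξ₀)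
    (hcell : j + b + d % 2 ≤ jl) (hξv : Valued.v ξ₀ * Valued.v (jE ϖ) ^ jl = Valued.v (jE ϖ) ^ (2 * b + d % 2))
    {μa μb R₀ γ₀ : E} (hμab : lam - jE ((u : Matrix (Fin 1) (Fin 1) E) 0 0) = jE μa + jE μb * α)
    (hR₀ : jE R₀ = α * κ₀ + ρ (α * κ₀)) (hγ₀ : jE γ₀ = ξ₀ * (α - ρ α))
    {α₁ γ₁ : E}
    (haff : ∀ (T W f : E), σ T = T → Valued.v T = 1 → σ W = W → Valued.v W ≤ 1 → σ f = f →
      Valued.v ((μa + μb * R₀) * ((ϖ * σ ϖ) ^ b)⁻¹ + μb * γ₀ * ((ϖ * σ ϖ) ^ b)⁻¹ * W) = Valued.v ((μa + μb * R₀) * ((ϖ * σ ϖ) ^ b)⁻¹) →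
      Valued.v (T * ((μa + μb * R₀) * ((ϖ * σ ϖ) ^ b)⁻¹ + μb * γ₀ * ((ϖ * σ ϖ) ^ b)⁻¹ * W) - f * ((ϖ - σ ϖ) * ((ϖ * σ ϖ) ^ ((d - d % 2) / 2))⁻¹)) ≤
        Valued.v ϖ ^ mstarOfRecord d → normSign σ f = normSign σ T * normSign σ (α₁ + γ₁ * W))
    -- the vertex
    {Λ : AddSubgroup M} (hΛ : Λ ∈ levelSetDep ρ Θ α (jE ϖ) h j b (lam - jE ((u : Matrix (Fin 1) (Fin 1) E) 0 0)))
    {B : Submodule 𝒪[E] (Fin 2 → E)} (hBΛ : B.toAddSubgroup.map φ = Λ)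
    {L₃ : Submodule 𝒪[E] (Fin 3 → E)} (hL : IsSelfDualLattice σ ϖ (!![H₂ 0 0, 0, H₂ 0 1; 0, hW, 0; H₂ 1 0, 0, H₂ 1 1] : Matrix (Fin 3) (Fin 3) E) L₃)
    (hLB : L₃ ⊓ LinearMap.ker ((LinearMap.proj (1 : Fin 3) : (Fin 3 → E) →ₗ[E] E).restrictScalars 𝒪[E]) =
      B.map ((Matrix.toLin' (!![1, 0; 0, 0; 0, 1] : Matrix (Fin 3) (Fin 2) E)).restrictScalars 𝒪[E]))
    (htube : ∀ c : E, (Pi.single 1 c : Fin 3 → E) ∈ L₃ ↔ Valued.v c ≤ Valued.v ϖ ^ b) :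
    ∃ (x₁ : M) (w₀ : Fin 2 → E) (V₁ : E), x₁ ≠ 0 ∧ (∀ x, x ∈ Λ ↔ ∃ z, IsOrd ρ α (jE ϖ ^ j) z ∧ x = x₁ * z) ∧
      IsOrd ρ α (jE ϖ ^ j) (dualGen ρ Θ α (jE ϖ ^ j) h x₁) ∧ ¬ IsOrd ρ α (jE ϖ ^ j) (dualGen ρ Θ α (jE ϖ ^ j) h x₁ / jE ϖ) ∧
      Valued.v (dualGen ρ Θ α (jE ϖ ^ j) h x₁) = Valued.v (jE ϖ) ^ b ∧ φ w₀ = (dualGen ρ Θ α (jE ϖ ^ j) h x₁)⁻¹ * x₁ ∧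
      (jE ϖ ^ j * (α - ρ α) * Θ (dualGen ρ Θ α (jE ϖ ^ j) h x₁))⁻¹ + ρ (jE ϖ ^ j * (α - ρ α) * Θ (dualGen ρ Θ α (jE ϖ ^ j) h x₁))⁻¹ = jE (pairing σ H₂ w₀ w₀) ∧
      σ (pairing σ H₂ w₀ w₀) = pairing σ H₂ w₀ w₀ ∧ Valued.v (pairing σ H₂ w₀ w₀ * (ϖ * σ ϖ) ^ b) = 1 ∧
      σ V₁ = V₁ ∧ Valued.v V₁ ≤ 1 ∧
      (jE ϖ ^ j * (α - ρ α) * Θ (dualGen ρ Θ α (jE ϖ ^ j) h x₁))⁻¹ * (jE (pairing σ H₂ w₀ w₀))⁻¹ = κ₀ + jE V₁ * ξ₀ ∧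
      ρ (h * (x₁ * Θ x₁)) / (h * (x₁ * Θ x₁) + ρ (h * (x₁ * Θ x₁))) = κ₀ + jE V₁ * ξ₀ ∧
      (∀ Ms : ℕ, d % 2 ≤ Ms → Ms ≤ mcOfRecord d →
        (LatticeNearTransvShell ϖ (d % 2) Ms ((((endoGL (γ₂, u) : GL (Fin 3) E) : Matrix (Fin 3) (Fin 3) E) - 1)) L₃ ↔
          Valued.v (μa + μb * (R₀ + V₁ * γ₀)) = Valued.v ϖ ^ (2 * b + d % 2))) ∧
      (Valued.v (μa + μb * (R₀ + V₁ * γ₀)) = Valued.v ϖ ^ (2 * b + d % 2) →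
        ∀ W : E, σ W = W → Valued.v W ≤ 1 → Valued.v (μa + μb * (R₀ + W * γ₀)) = Valued.v ϖ ^ (2 * b + d % 2) →
        Valued.v (μb * γ₀) * Valued.v (W - V₁) ≤ Valued.v ϖ ^ (2 * b + mstarOfRecord d) →
        ({z : E | ∃ y ∈ L₃, Valued.v ((ϖ ^ mstarOfRecord d)⁻¹ * (z - pairing σ (!![H₂ 0 0, 0, H₂ 0 1; 0, hW, 0; H₂ 1 0, 0, H₂ 1 1] : Matrix (Fin 3) (Fin 3) E) y
          ((((endoGL (γ₂, u) : GL (Fin 3) E) : Matrix (Fin 3) (Fin 3) E) - 1) *ᵥ y))) ≤ 1} = valueSetMod σ ϖ (mstarOfRecord d) (xPlus σ ϖ d) ↔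
        normSign σ (pairing σ H₂ w₀ w₀ * (ϖ * σ ϖ) ^ b) * normSign σ (α₁ + γ₁ * W) = 1)) := by
  obtain ⟨hσσ, hvσ, hϖ, -, -, hdpos, -⟩ := id hD
  obtain ⟨hϖ0, hϖlt, hjϖ0, hvjϖ0, hvjϖpos, hjϖlt, hjϖle⟩ := uniformizer_letters jE hjv hϖ
  have hπ : Valued.v (jE ϖ) = exp (-1 : ℤ) := by rw [hjiso, hϖ]
  have hπn : ∀ n : ℕ, Valued.v (jE ϖ) ^ n = exp (-(n : ℤ)) := fun n => by rw [hπ, ← exp_nsmul, nsmul_eq_mul, mul_neg, mul_one]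
  have hρj : ∀ c : E, ρ (jE c) = jE c := fun c => (hjfix _).2 ⟨c, rfl⟩
  have hm1 : mstarOfRecord d = d % 2 + 2 * d - 1 := rfl
  have hmc : mcOfRecord d = 2 * ((d % 2 + 2 * d - 1 + d) / 2) := rfl
  have hb1 : 1 ≤ b := by omega
  have hhW0 : hW ≠ 0 := fun h0 => by rw [h0, map_zero] at hhW; exact zero_ne_one hhW
  have hhW1 : Valued.v (jE hW) = 1 := by rw [hjiso, hhW]
  set μ : M := lam - jE ((u : Matrix (Fin 1) (Fin 1) E) 0 0) with hμdef
  set cc : M := jE ϖ ^ j with hccdef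
  have hρcc : ρ cc = cc := by rw [hccdef, map_pow, hρj]
  have hccv : Valued.v cc = Valued.v (jE ϖ) ^ j := by rw [hccdef, Valuation.map_pow]
  have hcc0 : cc ≠ 0 := pow_ne_zero _ hjϖ0
  have hcc1 : Valued.v cc ≤ 1 := by rw [hccv]; exact pow_le_one₀ zero_le hjϖle
  have hA0 : α - ρ α ≠ 0 := sub_ne_zero.2 (Ne.symm hα)
  have hccA : cc * (α - ρ α) ≠ 0 := mul_ne_zero hcc0 hA0
  have hccAv : Valued.v (cc * (α - ρ α)) = Valued.v (jE ϖ) ^ j := by rw [Valuation.map_mul, hU, mul_one, hccv]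
  have hμ2b : Valued.v μ = Valued.v (jE ϖ) ^ (2 * b + d % 2) := by rw [hm, hπn, hbm]
  have hμρ : Valued.v (μ - ρ μ) = Valued.v (jE ϖ) ^ jl := by rw [hjl, hπn]
  have hlamρ : lam - ρ lam = μ - ρ μ := by rw [hμdef, map_sub, hρj]; ring
  have hlamj : IsOrd ρ α cc lam := by
    refine ⟨hvlam.le, ?_⟩
    rw [hlamρ, hμρ, hccAv]; exact pow_le_pow_right_of_le_one' hjϖle (by omega)
  -- unpack the member and its glued vertex (★ p862869)
  obtain ⟨x₁, w₀, g₀, hx₁, hΛx, hyO, hyp, hylev, hw₀Y, hpr, hg₀, hg₀1, hprg⟩ :=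
    exists_presentation_of_mem_levelSetDep σ hσσ hvσ hϖ hH₂ hH₂σ hhW jE hρρ hvρ hα hα1 hint hΘΘ hΘρ hvΘ hjv hjfix hjpow hϖmax φ hφs hφi hφo hφγ hvlam hΘh hh hform
      ((u : Matrix (Fin 1) (Fin 1) E) 0 0) hb1 hlamj hΛ hBΛ hL hLB htube
  have hdep : IsOrd ρ α cc (μ / dualGen ρ Θ α cc h x₁) := by
    have h2 := ((mem_levelSetDep_iff ρ Θ α (jE ϖ) h j b μ Λ).1 hΛ).2
    exact (forall_herm_mul_mem_iff_isOrd_div hρρ hvρ hα hα1 hint hΘΘ hΘρ hvΘ hρcc hcc0 hcc1 hh hx₁ hΛx μ).1 h2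
  have hintL : ∀ y ∈ L₃, Valued.v (pairing σ (!![H₂ 0 0, 0, H₂ 0 1; 0, hW, 0; H₂ 1 0, 0, H₂ 1 1] : Matrix (Fin 3) (Fin 3) E) y y) ≤ 1 :=
    fun y hy => (mem_dualLatt σ _ L₃ y).1 (le_dualLatt_of_isVertexLattice hvσ hL hy) y hy
  -- the level-2 letters of ★ p864193 HEAD-bd (fence `m_c ≥ 2`, `jl ≥ j + 2`), `|μ| ≤ |ϖE²·Y|` (`b ≥ 1`)
  have hcb : Valued.v cc ≤ Valued.v (jE ϖ) ^ b := by rw [hccv]; exact pow_le_pow_right_of_le_one' hjϖle hbj.le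
  have hul : Valued.v ((u : Matrix (Fin 1) (Fin 1) E) 0 0 - 1) ≤ Valued.v (ϖ ^ (d % 2 + 1)) := by
    rw [Valuation.map_pow]; exact hun.trans (pow_le_pow_right_of_le_one' hϖlt.le (by omega))
  have hlam1 : Valued.v (lam - 1) ≤ Valued.v (jE ϖ) ^ (d % 2 + 1) := hlamn.trans (pow_le_pow_right_of_le_one' hjϖle (by omega))
  have hlamρ2 : Valued.v (lam - ρ lam) ≤ Valued.v (cc * (α - ρ α)) * Valued.v (jE ϖ) ^ (d % 2 + 1) := by
    rw [hlamρ, hμρ, hccAv, ← pow_add]; exact pow_le_pow_right_of_le_one' hjϖle (by omega)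
  have hμl : Valued.v μ ≤ Valued.v (jE ϖ ^ (d % 2 + 1) * dualGen ρ Θ α cc h x₁) := by
    rw [hμ2b, Valuation.map_mul, Valuation.map_pow, hylev, ← pow_add]; exact pow_le_pow_right_of_le_one' hjϖle (by omega)
  -- (L) the glue letter, the glue value, the `σ`-fixed unit `pw·(ϖσϖ)^b`
  set D₀ : M := cc * (α - ρ α) * Θ (dualGen ρ Θ α cc h x₁) with hD₀def
  set pw : E := pairing σ H₂ w₀ w₀ with hpwdef
  set P : E := (ϖ * σ ϖ) ^ b with hPdef
  have hTr : D₀⁻¹ + ρ D₀⁻¹ = jE pw := inv_add_map_inv_eq_map_pairing σ H₂ jE hΘΘ φ hh hform hccA hx₁ hw₀Y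
  obtain ⟨r, hr⟩ := exists_map_eq_glueUnit (Θ := Θ) (α := α) jE hρρ hΘρ hjfix cc h x₁ ϖ hW b
  obtain ⟨hσr, hr1⟩ := glue_fixed_unit (α := α) hD jE hjv hjfix hΘj hρρ hvρ hΘΘ hΘρ hvΘ hΘh hh hb1 hccA hFgap hx₁ hyO hyp hylev hhWσ hhW1 hr
  have hpwP : pw * P = -hW * r := pairing_mul_normPow_eq (α := α) jE hΘj hhW0 hTr hr
  have hpwv : Valued.v (pw * P) = 1 := by rw [hpwP, Valuation.map_mul, Valuation.map_neg, hhW, hr1, one_mul]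
  have hP0 : P ≠ 0 := pow_ne_zero _ (mul_ne_zero hϖ0 ((map_ne_zero σ).2 hϖ0))
  have hσP : σ P = P := by rw [hPdef, map_pow, map_mul, hσσ, mul_comm (σ ϖ) ϖ]
  have hσpw : σ pw = pw := by
    have h1 : σ (pw * P) = pw * P := by rw [hpwP, map_mul, map_neg, hhWσ, hσr]
    rw [map_mul, hσP] at h1
    exact mul_right_cancel₀ hP0 h1
  have hpw0 : pw ≠ 0 := fun h0 => by rw [h0, zero_mul, Valuation.map_zero] at hpwv; exact zero_ne_one hpwv
  -- the coordinate of the vertex: `D₀⁻¹·(jE pw)⁻¹ = ρu₀ ∕ t = κ₀ + jE V₁·ξ₀` (★ p863222's bridge + ★ p863914 (hV))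
  have hξ0 : ξ₀ ≠ 0 := fun h0 => by
    rw [h0, Valuation.map_zero, zero_mul] at hξv; exact pow_ne_zero _ hvjϖ0 hξv.symm
  have hξR : Valued.v (jE ϖ) ^ b ≤ Valued.v ξ₀ * Valued.v (cc * (α - ρ α)) := by
    rw [hccAv]
    have h1 : Valued.v ξ₀ * Valued.v (jE ϖ) ^ j * Valued.v (jE ϖ) ^ jl = Valued.v (jE ϖ) ^ (2 * b + d % 2 + j) := by
      rw [mul_assoc, mul_comm (Valued.v (jE ϖ) ^ j), ← mul_assoc, hξv, ← pow_add]
    have h2 : Valued.v (jE ϖ) ^ b * Valued.v (jE ϖ) ^ jl ≤ Valued.v (jE ϖ) ^ (2 * b + d % 2 + j) := by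
      rw [← pow_add]; exact pow_le_pow_right_of_le_one' hjϖle (by omega)
    rw [← h1] at h2
    exact le_of_mul_le_mul_right h2 (pow_pos hvjϖpos _)
  have hξ1 : 1 ≤ Valued.v ξ₀ := by
    have h1 : 1 * Valued.v (jE ϖ) ^ jl ≤ Valued.v ξ₀ * Valued.v (jE ϖ) ^ jl := by
      rw [one_mul, hξv]; exact pow_le_pow_right_of_le_one' hjϖle (by omega)
    exact le_of_mul_le_mul_right h1 (pow_pos hvjϖpos _)
  have hbridge : D₀⁻¹ * (jE pw)⁻¹ = ρ (h * (x₁ * Θ x₁)) / (h * (x₁ * Θ x₁) + ρ (h * (x₁ * Θ x₁))) := by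
    have hΘx₁ : Θ x₁ ≠ 0 := (map_ne_zero Θ).2 hx₁
    have hu₀ : h * (x₁ * Θ x₁) ≠ 0 := mul_ne_zero hh (mul_ne_zero hx₁ hΘx₁)
    have hρu₀ : ρ (h * (x₁ * Θ x₁)) ≠ 0 := (map_ne_zero ρ).2 hu₀
    obtain ⟨-, -, ht1⟩ := F0P3cDyRamRowCellFibreTransport.trace_letters (α := α) hρρ hΘΘ hΘρ hΘh (hρj ϖ) hjϖ0 hjϖle hb1 hccA hFgap hyO hyp hylev
    have ht0 : h * (x₁ * Θ x₁) + ρ (h * (x₁ * Θ x₁)) ≠ 0 := fun h0 => by rw [h0, map_zero] at ht1; exact zero_ne_one ht1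
    have hν0 : cc * (α - ρ α) * Θ (cc * (α - ρ α)) ≠ 0 := mul_ne_zero hccA ((map_ne_zero Θ).2 hccA)
    have hΘu : Θ (h * (x₁ * Θ x₁)) = h * (x₁ * Θ x₁) := by rw [map_mul, map_mul, hΘh, hΘΘ]; ring
    have hYY : dualGen ρ Θ α cc h x₁ * Θ (dualGen ρ Θ α cc h x₁) = (h * (x₁ * Θ x₁)) * (h * (x₁ * Θ x₁)) * (cc * (α - ρ α) * Θ (cc * (α - ρ α))) := by
      rw [dualGen_def, map_mul, hΘu]; ring
    rw [show D₀⁻¹ * (jE pw)⁻¹ = D₀⁻¹ / (D₀⁻¹ + ρ D₀⁻¹) by rw [hTr, div_eq_mul_inv], hD₀def,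
      ← Summit.HodgeConjecture.HodgeConjecture.Cruxes.H413.F0P3cDyRamRowVertexPopulationRead.dualScalar_eq_inv_cellScalar cc h x₁,
      Summit.HodgeConjecture.HodgeConjecture.Cruxes.H413.F0P3cDyRamRowVertexPopulationRead.trace_dualScalar_eq hρρ hΘΘ hΘρ hρcc hΘh hh hx₁ hccA, hYY]
    have key : ∀ {a r n : M}, a ≠ 0 → r ≠ 0 → n ≠ 0 → a + r ≠ 0 → a / (a * a * n) / ((a + r) / (a * r * n)) = r / (a + r) := by
      intro a r n ha hr hn ht
      rw [div_div_eq_mul_div, div_mul_eq_mul_div, div_div, div_eq_div_iff (mul_ne_zero (mul_ne_zero (mul_ne_zero ha ha) hn) ht) ht]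
      ring
    exact key hu₀ hρu₀ hν0 ht0
  obtain ⟨V₁, hjV₁, hσV₁, hV₁1⟩ := F0P3cDyRamRowCellSocketReads.exists_coord_of_gen (α := α) hD jE hjv hjfix hΘj hρρ hvρ hΘΘ hΘρ hΘh hb1 hccA hFgap hκ₀ hΘκ₀ hξ hΘξ hξ0
    (hκ₀1.trans hξ1) hξR Λ x₁ ⟨hx₁, hΛx, hyO, hyp, hylev⟩
  have hκ : D₀⁻¹ * (jE pw)⁻¹ = κ₀ + jE V₁ * ξ₀ := by
    rw [hbridge, hjV₁]; field_simp; ring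
  -- the `E`-coordinates of `μ` and the chart's digit sizes
  have hμbv : Valued.v (jE μb) = Valued.v (jE ϖ) ^ jl := by
    have e : jE μb = (μ - ρ μ) / (α - ρ α) := by
      have h1 : μ - ρ μ = jE μb * (α - ρ α) := by rw [hμab, map_add, map_mul, hρj, hρj]; ring
      rw [h1, mul_div_cancel_right₀ _ hA0]
    rw [e, map_div₀, hμρ, hU, div_one]
  have hμav : Valued.v (jE μa) = Valued.v (jE ϖ) ^ (2 * b + d % 2) := by
    have e : jE μa = μ - jE μb * α := by rw [hμab]; ring
    have hlt : Valued.v (jE μb * α) < Valued.v μ := by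
      rw [Valuation.map_mul, hμbv, hμ2b]
      calc Valued.v (jE ϖ) ^ jl * Valued.v α ≤ Valued.v (jE ϖ) ^ jl * 1 := mul_le_mul' le_rfl hα1
        _ < Valued.v (jE ϖ) ^ (2 * b + d % 2) := by rw [mul_one]; exact pow_lt_pow_right_of_lt_one₀ hvjϖpos hjϖlt (by omega)
    rw [e, Valuation.map_sub_eq_of_lt_left _ hlt, hμ2b]
  have hR₀v : Valued.v (jE R₀) ≤ 1 := by
    rw [hR₀]
    refine (Valuation.map_add _ _ _).trans (max_le ?_ ?_)
    · rw [Valuation.map_mul]; exact mul_le_one' hα1 hκ₀1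
    · rw [hvρ, Valuation.map_mul]; exact mul_le_one' hα1 hκ₀1
  have hâ : Valued.v (μa + μb * R₀) = Valued.v ϖ ^ (2 * b + d % 2) := by
    rw [← hjiso, map_add, map_mul]
    have hlt : Valued.v (jE μb * jE R₀) < Valued.v (jE μa) := by
      rw [Valuation.map_mul, hμbv, hμav]
      calc Valued.v (jE ϖ) ^ jl * Valued.v (jE R₀) ≤ Valued.v (jE ϖ) ^ jl * 1 := mul_le_mul' le_rfl hR₀v
        _ < Valued.v (jE ϖ) ^ (2 * b + d % 2) := by rw [mul_one]; exact pow_lt_pow_right_of_lt_one₀ hvjϖpos hjϖlt (by omega)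
    rw [Valuation.map_add_eq_of_lt_left _ hlt, hμav, hjiso]
  -- the ray-domination letter at `m′ := m⋆`, the population token, the deep tokens
  set μt : M := μ * (jE (ϖ ^ mstarOfRecord d))⁻¹ with hμtdef
  have hϖm0 : jE (ϖ ^ mstarOfRecord d) ≠ 0 := by rw [map_pow]; exact pow_ne_zero _ hjϖ0
  have hμt : μ = jE (ϖ ^ mstarOfRecord d) * μt := by rw [hμtdef]; field_simp
  have hμtO : IsOrd ρ α cc μt := by
    have hϖmv : Valued.v (jE (ϖ ^ mstarOfRecord d)) = Valued.v (jE ϖ) ^ mstarOfRecord d := by rw [map_pow, Valuation.map_pow]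
    refine ⟨?_, ?_⟩
    · rw [hμtdef, Valuation.map_mul, map_inv₀, hμ2b, hϖmv, ← div_eq_mul_inv, div_le_one₀ (pow_pos hvjϖpos _)]
      exact pow_le_pow_right_of_le_one' hjϖle (by omega)
    · have e : μt - ρ μt = (μ - ρ μ) * (jE (ϖ ^ mstarOfRecord d))⁻¹ := by rw [hμtdef, map_mul, map_inv₀, hρj]; ring
      rw [e, Valuation.map_mul, map_inv₀, hμρ, hϖmv, hccAv, ← div_eq_mul_inv, div_le_iff₀ (pow_pos hvjϖpos _), ← pow_add]
      exact pow_le_pow_right_of_le_one' hjϖle (by omega)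
  have huu : ((u : Matrix (Fin 1) (Fin 1) E) 0 0) * σ ((u : Matrix (Fin 1) (Fin 1) E) 0 0) = 1 := line_entry_mul_map_eq_one σ hhW0 hA hΓ
  have hn : 3 * d - 2 + d % 2 ≤ mcOfRecord d := by omega
  have hsk : Valued.v (μ / dualGen ρ Θ α cc h x₁) * Valued.v (lam - ρ lam) ≤ Valued.v (jE ϖ) ^ mcOfRecord d * Valued.v (cc * (α - ρ α)) := by
    rw [map_div₀, hylev, hμ2b, hlamρ, hμρ, hccAv, ← pow_add]
    have h1 : Valued.v (jE ϖ) ^ (2 * b + d % 2) / Valued.v (jE ϖ) ^ b = Valued.v (jE ϖ) ^ (b + d % 2) := by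
      rw [div_eq_iff (pow_ne_zero _ hvjϖ0), ← pow_add]; congr 1; omega
    rw [h1, ← pow_add]
    exact pow_le_pow_right_of_le_one' hjϖle (by omega)
  -- the ray scalar in the chart: `e₀ = pw·(μ_a + μ_b(R₀ + V₁γ₀))` (★ p862871), `|e₀|·|P| = |μ_a + μ_b(R₀ + V₁γ₀)|`
  set e₀ : E := pw * (μa + μb * (R₀ + V₁ * γ₀)) with he₀def
  have he₀ : jE e₀ = μ / D₀ + ρ (μ / D₀) := by
    rw [hμab, he₀def]; exact (rayScalar_eq_affine (α := α) jE hρj hρρ hTr hpw0 hξ (by rw [hρj]) hκ hR₀ hγ₀ μa μb).symm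
  have hPv : Valued.v P = Valued.v ϖ ^ (2 * b) := by rw [hPdef, Valuation.map_pow, Valuation.map_mul, hvσ, ← pow_two, ← pow_mul, mul_comm]
  have hPv0 : Valued.v P ≠ 0 := (Valuation.ne_zero_iff _).2 hP0
  have hkey : Valued.v e₀ * Valued.v P = Valued.v (μa + μb * (R₀ + V₁ * γ₀)) := by
    rw [he₀def, Valuation.map_mul, mul_right_comm, ← Valuation.map_mul, hpwv, one_mul]
  -- (S′) the shell ↔ the coordinate is ON the shell (★ p864193 HEAD-bd)
  have hS : ∀ Ms : ℕ, d % 2 ≤ Ms → Ms ≤ mcOfRecord d →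
      (LatticeNearTransvShell ϖ (d % 2) Ms ((((endoGL (γ₂, u) : GL (Fin 3) E) : Matrix (Fin 3) (Fin 3) E) - 1)) L₃ ↔
        Valued.v (μa + μb * (R₀ + V₁ * γ₀)) = Valued.v ϖ ^ (2 * b + d % 2)) := by
    intro Ms hMl hMc
    have huk : Valued.v ((u : Matrix (Fin 1) (Fin 1) E) 0 0 - 1) ≤ Valued.v (ϖ ^ (Ms - d % 2)) := by
      rw [Valuation.map_pow]; exact hun.trans (pow_le_pow_right_of_le_one' hϖlt.le (by omega))
    have hμk : Valued.v μ ≤ Valued.v (jE ϖ) ^ (Ms - d % 2) := by rw [hμ2b]; exact pow_le_pow_right_of_le_one' hjϖle (by omega)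
    have hprod : Valued.v μ * Valued.v (μ - ρ μ) ≤ Valued.v (cc * (α - ρ α)) * Valued.v (dualGen ρ Θ α cc h x₁) * Valued.v (jE ϖ) ^ Ms := by
      rw [hμ2b, hμρ, hccAv, hylev, ← pow_add, ← pow_add, ← pow_add]; exact pow_le_pow_right_of_le_one' hjϖle (by omega)
    rw [latticeNearTransvShell_iff_v_rayScalar_eq_pow hρρ hvρ hΘΘ hΘρ hvΘ hϖ jE hjv hjfix φ hφs hφi hφγ hΘh htube hpr hLB.symm hg₀ hg₀1 hprg hBΛ hρcc hccA hx₁ hΛx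
      hw₀Y hylev u (d % 2) (Ms - d % 2) Ms (by omega) huk hμk hprod hul hlam1 hlamρ2 hμl he₀, ← mul_left_inj' hPv0, hkey, hPv, ← pow_add, Nat.add_comm (d % 2) (2 * b)]
  -- (L′) «M1-NX» on the shell
  have hL : Valued.v (μa + μb * (R₀ + V₁ * γ₀)) = Valued.v ϖ ^ (2 * b + d % 2) →
      ∀ W : E, σ W = W → Valued.v W ≤ 1 → Valued.v (μa + μb * (R₀ + W * γ₀)) = Valued.v ϖ ^ (2 * b + d % 2) →
      Valued.v (μb * γ₀) * Valued.v (W - V₁) ≤ Valued.v ϖ ^ (2 * b + mstarOfRecord d) →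
      ({z : E | ∃ y ∈ L₃, Valued.v ((ϖ ^ mstarOfRecord d)⁻¹ * (z - pairing σ (!![H₂ 0 0, 0, H₂ 0 1; 0, hW, 0; H₂ 1 0, 0, H₂ 1 1] : Matrix (Fin 3) (Fin 3) E) y
          ((((endoGL (γ₂, u) : GL (Fin 3) E) : Matrix (Fin 3) (Fin 3) E) - 1) *ᵥ y))) ≤ 1} = valueSetMod σ ϖ (mstarOfRecord d) (xPlus σ ϖ d) ↔
        normSign σ (pairing σ H₂ w₀ w₀ * (ϖ * σ ϖ) ^ b) * normSign σ (α₁ + γ₁ * W) = 1) := by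
    intro hNX W hσW hW1 hWNX hWV
    exact valueSet_rowVertex_eq_xPlus_iff_affineSign_of_onShell_of_near hD H₂ hW jE hjv hjfix hρρ hvρ hα hα1 hint hΘΘ hΘρ hvΘ hΘj φ hφs hφγ hh hΘh hform hpr hintL
      hLB.symm hg₀ hg₀1 hprg u hρcc hcc0 hcc1 hccA hx₁ hBΛ hΛx hw₀Y hyO hμt hμtO le_rfl hΘlam hvlam huu hdep hn hlamn hun hsk hμab hσpw hpwv hξ hσV₁ hV₁1 hκ hR₀ hγ₀ hâ hNX
      hσW hW1 hWNX hWV haff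
  exact ⟨x₁, w₀, V₁, hx₁, hΛx, hyO, hyp, hylev, hw₀Y, hTr, hσpw, hpwv, hσV₁, hV₁1, hκ, hbridge ▸ hκ, hS, hL⟩

end Summit.HodgeConjecture.HodgeConjecture.Cruxes.H413.F0P3cDyRamRowTowerTopVertexLetters

end
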